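import Literature.AnabelianGeometry.EtaleTheta.Discharge.Sec5Thm56EndKnitLevelNPsiModelHypsGalois
import Literature.AnabelianGeometry.EtaleTheta.Discharge.Sec5Lem59vOfConnectedTemperoidLevelNGalois
import Literature.AnabelianGeometry.EtaleTheta.Discharge.Sec5Lem59vOfConnectedTemperoidLevelN
import HarnessLib
import HarnessLib.Audit.LibrarySuggestionsDenyListEtaleTheta

/-!
# [EtTh] Lemma 5.9 (v) at the genuine level-`N` data with the normalisation `hme` and the Prop. 5.5 ⊕ Thm. 5.6 (i) chain KNIT IN (`CycRigidityCoincide` for THE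
# rigidity family) ON THE v2 SUBQUOTIENT RECORD `ThetaSubquotientProjGalois` — PROOF-ONLY, proofs verbatim

S. Mochizuki, *The étale theta function and its Frobenioid-theoretic manifestations*, Publ. RIMS **45** (2009)
[cite: MochizukiEtTh2009, Lem 5.9 (v) p.332 (PDF p.106); Thm 5.6 p.328–329 (PDF pp.102–103); Prop 5.5 p.327 (PDF p.101); §5 p.327 (PDF p.101) «these subquotients determine subquotients `Aut_D(D) ↠ Aut^Θ_D(D)`»].
abc-iut cell, layer L2, seat abc-iut-w6-d020 (gen 7), row «(w4-S) V1→V2 PORT — deep EndKnit*/AllLeavesV3*/KummerComparisonInputsLevel*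
heads» (abc-iut-L2-lead gen 7 R957; VNEXT-CENSUS-L2 §G5 add. 11 standing row «(w4)»), layer S4h = the two remaining heads of `Sec5Lem59vOfConnectedTemperoidLevelN` (abc-iut-w4-d042; the first five are abc-iut-w6-d079's p483596 `…LevelNGalois`).

WHY.  abc-iut-w4-d042's `cycRigidityCoincide_ofConnectedTemperoidData_levelN_of_hme` (Lemma 5.9 (v) `CycRigidityCoincide` at the level-`N` data under the K4 normalisation
`hme`) and `exists_rigidityFamily_unique_preserved_cycRigidityCoincide_ofConnectedTemperoidData_levelN` (the same for THE rigidity family of the merged END KNIT) bind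
abc-iut-L2-t4's v1 record `(P : ThetaSubquotientProj 𝔉)` asks `proj_surjective` at EVERY base object and is EMPTY at the cell's root model for
`l` odd (abc-iut-L2-t9 p456572, kernel certificate p476337), so there each of these theorems quantifies over an empty type; abc-iut-w6-d079's v2
record `ThetaSubquotientProjGalois 𝔉 Gal` (p481123; surjectivity only at the objects singled out by `Gal`, as print uses it — Prop. 5.1 / Lemma 5.9
run over connected GALOIS coverings) is INHABITED at every `ofSetting` carrier (p481568) and at every level stub of the junction data (p486065
`RigidData.nonempty_thetaSubquotientProjGalois_of_stub_eq_levelStub`); the v2 clauses `ThetaSubquotientProjGalois.IsKummerDetermined` /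
`.CyclotomicRigidity` (p481123 / p484491) and the predicate twins `Thm56Sub.*Gal` (p484491) are the SAME formulas (they read `P` only through
`pre` / `proj` at `Base(B_N)`).

THIS FILE re-keys the listed theorems on the v2 record — binder `{Gal} (P : ThetaSubquotientProjGalois 𝔉 Gal)`, statements otherwise and
proofs VERBATIM (none of the source arguments uses `proj_surjective`), names = the originals with suffix `_galois`: 
`cycRigidityCoincide_ofConnectedTemperoidData_levelN_of_hme_galois`, `exists_rigidityFamily_unique_preserved_cycRigidityCoincide_ofConnectedTemperoidData_levelN_galois` —
consuming abc-iut-w6-d079's `cycRigidityCoincide_ofConnectedTemperoidData_levelN_galois` (p483596) and this seat's S4e twins BY NAME.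
0 `def`s; no v1 file is edited or restated (the `P`-free producers of the sources are consumed BY NAME); the v1 heads are the `P.toGalois Gal`
instances of these twins (abc-iut-w6-d079's `Iff.rfl` bridges `isKummerDetermined_toGalois_iff`, `cyclotomicRigidity_toGalois_iff`, `…Gal_toGalois_iff`).

HONEST FRAMING: a typing repair of the cell's OWN record (weaker quantifier on `P`, as print uses it); kernel-checked implications between typed
statements over abc-iut-L2-t4's assembled §5 data; every named leaf / binder of the v1 heads stays NAMED exactly as there; nothing of [EtTh]
(a refereed paper) is asserted; the existence of the data for an actual curve is not claimed; typed ≠ discharged; nothing here bears on [IUTchIII]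
Cor. 3.12 — no side taken; nothing here asserts abc proved or refuted.
-/

noncomputable section

namespace Literature.AnabelianGeometry.EtaleTheta

open CategoryTheory Opposite FrobenioidCyclotomicRigidity Literature.AlgebraicGeometry.Frobenioids
  Literature.AnabelianGeometry.SemiGraphs Literature.AnabelianGeometry.SemiGraphs.GaloisObjects

universe u₀ v₀ u v w w' v₁ u₁

namespace ThetaFrobenioid

section Connected

variable {K : Type u₀} [Field K] {X : SemiGraphs.TemperedArithmeticGroup.{u₀} K} {D₀ : Type u₀} [Category.{v₀} D₀]
  {V : FrdIMonoidStub.{max u₀ w'}} {T₀ : RealifiedDivisorMonoids (D₀ := D₀) V}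
  {VD : FrdICatStub.{u₀ + 1, u₀, max u₀ w'} (ConnectedPart (BTemp X.Pi))}
  {tf : TemperedFrobenioid T₀ (ConnectedPart (BTemp X.Pi)) VD} {hZ : tf.monoidType = MonoidType.Z}
  {hP : ∀ A : (ConnectedPart (BTemp X.Pi))ᵒᵖ, IsPerfect (tf.Φ.carrier A)}
  {NH : Subgroup (Field.absoluteGaloisGroup K) → tf.category → ℕ+ → Prop} {A₀ : tf.category}
  {hA₀ : PreFrobenioid.IsFrobeniusTrivial tf.toElem A₀} {hA₀' : SemiGraphs.IsGaloisObj A₀.base.obj}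
  {lv N : ℕ+} {l' : ℕ} {RD : RigidData.{max u₀ w'} N l'}
  {pullFrac : ∀ {A A' : (BiKummerSetting.mkOfConnectedTemperoid X tf hZ hP NH A₀ hA₀ hA₀').C} (_ : A' ⟶ A),
    (BiKummerSetting.mkOfConnectedTemperoid X tf hZ hP NH A₀ hA₀ hA₀').biratUnits A →
      (BiKummerSetting.mkOfConnectedTemperoid X tf hZ hP NH A₀ hA₀ hA₀').biratUnits A'}
  {θ : (BiKummerSetting.mkOfConnectedTemperoid X tf hZ hP NH A₀ hA₀ hA₀').biratUnits
    (BiKummerSetting.mkOfConnectedTemperoid X tf hZ hP NH A₀ hA₀ hA₀').Aodot}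
  {Bl : (BiKummerSetting.mkOfConnectedTemperoid X tf hZ hP NH A₀ hA₀ hA₀').C}
  {Pl : (BiKummerSetting.mkOfConnectedTemperoid X tf hZ hP NH A₀ hA₀ hA₀').FractionPair θ Bl}
  {Rl : (BiKummerSetting.mkOfConnectedTemperoid X tf hZ hP NH A₀ hA₀ hA₀').NthRoot θ Pl lv pullFrac}
  (h : ModelFrobenioid.Hypotheses tf.divisorMonoid tf.ratFnFunctor)
  (odd_l : Odd (lv : ℕ))
  (R : (BiKummerSetting.mkOfConnectedTemperoid X tf hZ hP NH A₀ hA₀ hA₀').NthRoot Rl.root Rl.pair N pullFrac)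
  (ιX : RD.PiX ≃ₜ* X.Pi) (K' : Type (max u₀ w')) [Field K'] (constEmb : K'ˣ →* tf.biratUnitsModel R.BN)
  (constEmb_injective : Function.Injective constEmb)
  (hinvc : ∀ g : Aut R.AN.base,
    pull tf.divisorMonoid g.hom (ModelFrobenioid.div R.pair.num) = ModelFrobenioid.div R.pair.num)
  (hinvp : ∀ y : RD.PiX, y ∈ RD.PiYdd →
    pull tf.divisorMonoid ((BiKummerSetting.mkOfConnectedTemperoid X tf hZ hP NH A₀ hA₀ hA₀').galoisSurj R.AN.base
      R.αData.isGalois (ιX y)).hom (ModelFrobenioid.div R.pair.den) = ModelFrobenioid.div R.pair.den)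
  [RD.iotaN.range.Normal]

variable {Gal : ConnectedPart (BTemp X.Pi) → Prop}

set_option linter.unusedSectionVars false in
/-- **Lemma 5.9 (v) at the genuine data in the K4 knit's currency**: with the knit's `ν : (l·Δ_Θ)_{B_N} ⊗ ℤ/Nℤ ⥲ μ_N(B_N)`, cyclotome dictionary
`m : μ_N(B_N) ⥲ μ_N` and its coefficient-free binder `hme` VERBATIM (`m (ν [proj(ρ k)]) = θ-mod(k)`), every Kummer-determined `ρ` has
`ρ_{B_N} = ν ≫ m ≫ m_i⁻¹ = rho219OfBiTheta (ν ≫ m)`.  [cite: MochizukiEtTh2009, Lem 5.9 (v) p.332 (PDF p.106)] -/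
theorem cycRigidityCoincide_ofConnectedTemperoidData_levelN_of_hme_galois
    (h1 : (ofConnectedTemperoidData h (RD.levelStub ιX) odd_l R ιX K' constEmb constEmb_injective hinvc hinvp).SectionsFactor)
    (h3 : (ofConnectedTemperoidData h (RD.levelStub ιX) odd_l R ιX K' constEmb constEmb_injective hinvc hinvp).OuterActionLZ)
    (hsec : (ofConnectedTemperoidData h (RD.levelStub ιX) odd_l R ιX K' constEmb constEmb_injective hinvc hinvp).SgpCapSection)
    (hcs : (ofConnectedTemperoidData h (RD.levelStub ιX) odd_l R ιX K' constEmb constEmb_injective hinvc hinvp).SgpCupSection)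
    (h8 : (ofConnectedTemperoidData h (RD.levelStub ιX) odd_l R ιX K' constEmb constEmb_injective hinvc hinvp).ConstantsEqNormalizer)
    (DK : Set (TopOut (ofConnectedTemperoidData h (RD.levelStub ιX) odd_l R ιX K' constEmb constEmb_injective hinvc hinvp).EPiN))
    (h59iv : (ofConnectedTemperoidData h (RD.levelStub ιX) odd_l R ιX K' constEmb constEmb_injective hinvc hinvp).EnvIsoBiTheta h1 h3 hsec hcs
      h8 DK RD.toThetaEnvData (ContinuousMulEquiv.refl _))
    (hB : (ofConnectedTemperoidData h (RD.levelStub ιX) odd_l R ιX K' constEmb constEmb_injective hinvc hinvp).IsThetaSaturated (ofConnectedTemperoidData h (RD.levelStub ιX) odd_l R ιX K' constEmb constEmb_injective hinvc hinvp).BN)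
    (P : ThetaSubquotientProjGalois (ofConnectedTemperoidData h (RD.levelStub ιX) odd_l R ιX K' constEmb constEmb_injective hinvc hinvp) Gal)
    (hPpre : P.pre R.BN.base =
      (ThetaSubquotient.autPre (RD.qN ιX) RD.iotaN R.BN.base.obj).comap (Functor.mapAut R.BN.base (connectedObjects (BTemp X.Pi)).ι))
    (ν : (ofConnectedTemperoidData h (RD.levelStub ιX) odd_l R ιX K' constEmb constEmb_injective hinvc hinvp).lDeltaModN (ofConnectedTemperoidData h (RD.levelStub ιX) odd_l R ιX K' constEmb constEmb_injective hinvc hinvp).BN ≃* (ofConnectedTemperoidData h (RD.levelStub ιX) odd_l R ιX K' constEmb constEmb_injective hinvc hinvp).muTorsion (ofConnectedTemperoidData h (RD.levelStub ιX) odd_l R ιX K' constEmb constEmb_injective hinvc hinvp).BN (ofConnectedTemperoidData h (RD.levelStub ιX) odd_l R ιX K' constEmb constEmb_injective hinvc hinvp).N)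
    (m : (ofConnectedTemperoidData h (RD.levelStub ιX) odd_l R ιX K' constEmb constEmb_injective hinvc hinvp).muTorsion (ofConnectedTemperoidData h (RD.levelStub ιX) odd_l R ιX K' constEmb constEmb_injective hinvc hinvp).BN (ofConnectedTemperoidData h (RD.levelStub ιX) odd_l R ιX K' constEmb constEmb_injective hinvc hinvp).N ≃* RD.mu)
    (hme : ∀ (k : RD.PiYdd) (hk : (k : RD.PiX) ∈ RD.lDeltaTheta) (hm : rhoOfBiKummerData R ιX k ∈ P.pre _),
      m (ν (QuotientGroup.mk (P.proj _ ⟨rhoOfBiKummerData R ιX k, hm⟩) : (ofConnectedTemperoidData h (RD.levelStub ιX) odd_l R ιX K' constEmb constEmb_injective hinvc hinvp).lDeltaModN (ofConnectedTemperoidData h (RD.levelStub ιX) odd_l R ιX K' constEmb constEmb_injective hinvc hinvp).BN)) = RD.thetaMod ⟨k, hk⟩)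
    (ρ : RigidityFamily (ofConnectedTemperoidData h (RD.levelStub ιX) odd_l R ιX K' constEmb constEmb_injective hinvc hinvp))
    (hρ : ThetaSubquotientProjGalois.IsKummerDetermined (𝔉 := ofConnectedTemperoidData h (RD.levelStub ιX) odd_l R ιX K' constEmb constEmb_injective hinvc hinvp) P ρ hB) :
    (ofConnectedTemperoidData h (RD.levelStub ιX) odd_l R ιX K' constEmb constEmb_injective hinvc hinvp).CycRigidityCoincide
      ((ofConnectedTemperoidData h (RD.levelStub ιX) odd_l R ιX K' constEmb constEmb_injective hinvc hinvp).rho219OfBiTheta h1 h3 hsec hcs h8 DK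
        RD.toThetaEnvData (ContinuousMulEquiv.refl _) h59iv.2.2.choose_spec.choose h59iv.2.2.choose_spec.choose_spec.choose
        h59iv.2.2.choose_spec.choose_spec.choose_spec.1 (ν.trans m)) ρ hB :=
  cycRigidityCoincide_ofConnectedTemperoidData_levelN_galois.{u₀, v₀, w'} h odd_l R ιX K' constEmb constEmb_injective hinvc hinvp h1 h3 hsec hcs h8 DK
    h59iv hB P     hPpre ρ hρ (ν.trans m) (fun k hk hm => (MulEquiv.trans_apply ν m _).trans (hme k hk hm))

set_option linter.unusedSectionVars false in
/-- **[EtTh] Prop. 5.5 ⊕ Thm. 5.6 (i) ⊕ Lemma 5.9 (v) AT THE GENUINE §5 DATA** (level `N`, any Frobenius-trivial Galois `A_⊙`): the MERGED K4 end knit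
(`exists_rigidityFamily_unique_preserved_ofConnectedTemperoidData_levelN_projPin_modelHyps_psi_galois`, p448631 — abc-iut-w5-d034 / w5-d020 / w5-d013 /
w4-d042; binders VERBATIM, consumed BY NAME) composed with `cycRigidityCoincide_ofConnectedTemperoidData_levelN_of_hme_galois`: THE Prop. 5.5 family `ρ`
(Kummer-determined, functorial-linear, unique, its cyclotomic rigidity preserved by `Ψ`) moreover satisfies Lemma 5.9 (v) at `B_N` — in the
situation of Lemma 5.9 (iv) (`EnvIsoBiTheta` BY NAME, at the sections `s^Π-fac` / outer `l·ℤ` / `s^⊓-gp` / `s^⊔-gp` / Lemma 5.8 supplied by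
`H : Facts`), `ρ_{B_N} = (ν ≫ m) ≫ m_i⁻¹`.  Residual binders = those of p448631 PLUS {`DK`, Lemma 5.9 (iv)}.
[cite: MochizukiEtTh2009, Lem 5.9 (v) p.332 (PDF p.106); Prop 5.5 p.327 (PDF p.101); Thm 5.6 p.328–329 (PDF pp.102–103)] -/
theorem exists_rigidityFamily_unique_preserved_cycRigidityCoincide_ofConnectedTemperoidData_levelN_galois
    -- Prop 5.5 side (η / ν pin, reachability, stub laws)
    (hB : (ofConnectedTemperoidData h (RD.levelStub ιX) odd_l R ιX K' constEmb constEmb_injective hinvc hinvp).IsThetaSaturated (ofConnectedTemperoidData h (RD.levelStub ιX) odd_l R ιX K' constEmb constEmb_injective hinvc hinvp).BN) (P : ThetaSubquotientProjGalois (ofConnectedTemperoidData h (RD.levelStub ιX) odd_l R ιX K' constEmb constEmb_injective hinvc hinvp) Gal)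
    -- the ONE pin: `P` at `B_N^bs` is print's `Aut`-subquotient domain `autPre q_N ι_N` read through `Aut_D(B_N^bs) ↪ Aut(B_N^bs.obj)`
    -- (abc-iut-w4-d042's `hPpre`; DUAL CLAUSE G-w4d042g3-1: no `P`-TERM until v-next `proj_surjective_of_isGaloisObj`)
    (hPpre : P.pre R.BN.base =
      (ThetaSubquotient.autPre (RD.qN ιX) RD.iotaN R.BN.base.obj).comap (Functor.mapAut R.BN.base (connectedObjects (BTemp X.Pi)).ι))
    -- the SECOND pin (abc-iut-w4-d042): `P.proj` at `B_N^bs` IS print's `autProj` read through `Aut_D(B_N^bs) ↪ Aut(B_N^bs.obj)` (cast-free form)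
    (hPproj_pin : ∀ (σ : P.pre R.BN.base) (τ : ThetaSubquotient.autPre (RD.qN ιX) RD.iotaN R.BN.base.obj),
      Functor.mapAut R.BN.base (connectedObjects (BTemp X.Pi)).ι (σ : Aut R.BN.base) = (τ : Aut R.BN.base.obj) →
        (P.proj R.BN.base σ : ThetaSubquotient.LDelta (RD.qN ιX) RD.iotaN R.BN.base.obj) =
          ThetaSubquotient.autProj (RD.qN ιX) RD.iotaN R.BN.base.obj τ)
    {η₀ : RD.PiYdd → RD.mu} (hη₀ : η₀ ∈ RD.thetaCocycles)
    (hdies : ∀ k : RD.PiYdd, rhoOfBiKummerData R ιX k = 1 → η₀ k = 1)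
    (ν : (ofConnectedTemperoidData h (RD.levelStub ιX) odd_l R ιX K' constEmb constEmb_injective hinvc hinvp).lDeltaModN (ofConnectedTemperoidData h (RD.levelStub ιX) odd_l R ιX K' constEmb constEmb_injective hinvc hinvp).BN ≃* (ofConnectedTemperoidData h (RD.levelStub ιX) odd_l R ιX K' constEmb constEmb_injective hinvc hinvp).muTorsion (ofConnectedTemperoidData h (RD.levelStub ιX) odd_l R ιX K' constEmb constEmb_injective hinvc hinvp).BN (ofConnectedTemperoidData h (RD.levelStub ιX) odd_l R ιX K' constEmb constEmb_injective hinvc hinvp).N)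
    -- hKν with the coefficient map ELIMINATED (abc-iut-w4-d042): «η ∘ ρ = e ∘ η₀» reads «η(ρ k) = mk (P.proj (ρ k'))» whenever `thetaMod k' = η₀ k`
    (hKν : ∀ η : (ofConnectedTemperoidData h (RD.levelStub ιX) odd_l R ιX K' constEmb constEmb_injective hinvc hinvp).HB → (ofConnectedTemperoidData h (RD.levelStub ιX) odd_l R ιX K' constEmb constEmb_injective hinvc hinvp).lDeltaModN (ofConnectedTemperoidData h (RD.levelStub ιX) odd_l R ιX K' constEmb constEmb_injective hinvc hinvp).BN,
      (∀ (k k' : RD.PiYdd) (hk' : (k' : RD.PiX) ∈ RD.lDeltaTheta) (hm' : rhoOfBiKummerData R ιX k' ∈ P.pre _),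
          RD.thetaMod ⟨k', hk'⟩ = η₀ k →
            η ⟨rhoOfBiKummerData R ιX k, Subgroup.mem_map_of_mem _ k.2⟩ =
              (QuotientGroup.mk (P.proj _ ⟨rhoOfBiKummerData R ιX k', hm'⟩) : (ofConnectedTemperoidData h (RD.levelStub ιX) odd_l R ιX K' constEmb constEmb_injective hinvc hinvp).lDeltaModN (ofConnectedTemperoidData h (RD.levelStub ιX) odd_l R ιX K' constEmb constEmb_injective hinvc hinvp).BN)) →
        FrobenioidThetaBiKummer.ThetaPairKummerClass (ofConnectedTemperoidData h (RD.levelStub ιX) odd_l R ιX K' constEmb constEmb_injective hinvc hinvp) η ν)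
    -- T56-L09b: Prop 3.4 (ii) constants + the origin clause «cnst kills Ker aug» (G-w5d020-2)
    {Dcnst : Type u₁} [Category.{v₁} Dcnst] {cnst : D₀ ⥤ Dcnst} (hP34 : RealifiedDivisorMonoids.Prop34Cnst T₀ cnst)
    (hΔcnst : ∀ δ ∈ RD.aug.ker,
      cnst.map (tf.base.map (rhoOfBiKummerData R ιX δ).hom) = 𝟙 (cnst.obj (tf.base.obj R.BN.base)))
    (hreach : LinearlyReachableFromBN (ofConnectedTemperoidData h (RD.levelStub ιX) odd_l R ιX K' constEmb constEmb_injective hinvc hinvp))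
    -- hKR (G-L6t23-3) by abc-iut-w4-d099's PIN route (p-file Sec5ThetaSectionCompatOfKummerClass): «Prop 5.2 (iii) enters ONCE» —
    -- the (η₀, ν) pin above + Facts + the cyclotome dictionary m with m ∘ ν ∘ e = id + cyclotomic-character compatibility (F-1306)
    (H : (ofConnectedTemperoidData h (RD.levelStub ιX) odd_l R ιX K' constEmb constEmb_injective hinvc hinvp).Facts)
    (m : (ofConnectedTemperoidData h (RD.levelStub ιX) odd_l R ιX K' constEmb constEmb_injective hinvc hinvp).muTorsion (ofConnectedTemperoidData h (RD.levelStub ιX) odd_l R ιX K' constEmb constEmb_injective hinvc hinvp).BN (ofConnectedTemperoidData h (RD.levelStub ιX) odd_l R ιX K' constEmb constEmb_injective hinvc hinvp).N ≃* RD.mu)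
    -- hme with the coefficient map ELIMINATED (abc-iut-w4-d042): `m ∘ ν ∘ e = id` reads `m (ν (mk (P.proj (ρ k)))) = thetaMod k` on `Π^tp_Ÿ ∩ (l·Δ_Θ)`
    (hme : ∀ (k : RD.PiYdd) (hk : (k : RD.PiX) ∈ RD.lDeltaTheta) (hm : rhoOfBiKummerData R ιX k ∈ P.pre _),
      m (ν (QuotientGroup.mk (P.proj _ ⟨rhoOfBiKummerData R ιX k, hm⟩) : (ofConnectedTemperoidData h (RD.levelStub ιX) odd_l R ιX K' constEmb constEmb_injective hinvc hinvp).lDeltaModN (ofConnectedTemperoidData h (RD.levelStub ιX) odd_l R ιX K' constEmb constEmb_injective hinvc hinvp).BN)) = RD.thetaMod ⟨k, hk⟩)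
    (hχX : (ofConnectedTemperoidData h (RD.levelStub ιX) odd_l R ιX K' constEmb constEmb_injective hinvc hinvp).CyclotomicCharacterCompatX RD.toThetaEnvData (MulEquiv.refl _) m)
    -- hdiff reduced to Π^tp_Ÿ ⊆ H_⊙ (`hfrac`, `haut` are THEOREMS here: [FrdI] Thm 5.2 (ii) dictionary, abc-iut-L2-t9/t4)
    (hH : ∀ y : RD.PiX, y ∈ RD.PiYdd → ιX y ∈ (BiKummerSetting.mkOfConnectedTemperoid X tf hZ hP NH A₀ hA₀ hA₀').Hodot)
    -- Thm 5.6 side: Ψ, its base shadow, Δ-transport and μ-pull data (abc-iut-L2-d4)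
    (Ψ : (BiKummerSetting.mkOfConnectedTemperoid X tf hZ hP NH A₀ hA₀ hA₀').C ≌ (BiKummerSetting.mkOfConnectedTemperoid X tf hZ hP NH A₀ hA₀ hA₀').C) (Ψbs : ConnectedPart (BTemp X.Pi) ⥤ ConnectedPart (BTemp X.Pi)) [Ψbs.IsEquivalence] (eΨ : Ψ.functor ⋙ (ofConnectedTemperoidData h (RD.levelStub ιX) odd_l R ιX K' constEmb constEmb_injective hinvc hinvp).base ≅ (ofConnectedTemperoidData h (RD.levelStub ιX) odd_l R ιX K' constEmb constEmb_injective hinvc hinvp).base ⋙ Ψbs)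
    -- the [SemiAnbd] Prop 3.2 datum of `Ψ^bs` and its level-`N` descent (∃-PRODUCED: abc-iut-w5-d013 p435495 / p438441; explicit here because
    -- the conclusion names the CONSTRUCTED Δ-transport `aΨ := deltaTransport …` of abc-iut-w5-d020, p443762)
    (φ : X.Pi ≃ₜ* X.Pi) (η : Ψbs ⋙ (connectedObjects (BTemp X.Pi)).ι ≅ (connectedObjects (BTemp X.Pi)).ι ⋙ BTemp.res (φ : X.Pi →ₜ* X.Pi))
    (φQ : RD.LevelQuot ≃* RD.LevelQuot) (φΛ : RD.mu ≃* RD.mu) (hq : ∀ g : X.Pi, RD.qN ιX (φ g) = φQ (RD.qN ιX g))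
    (hι : ∀ a : RD.mu, RD.iotaN (φΛ a) = φQ (RD.iotaN a))
    (hlin : PreFrobenioidData.PreservesMor Ψ.functor (ofConnectedTemperoidData h (RD.levelStub ιX) odd_l R ιX K' constEmb constEmb_injective hinvc hinvp).IsLinear (ofConnectedTemperoidData h (RD.levelStub ιX) odd_l R ιX K' constEmb constEmb_injective hinvc hinvp).IsLinear)
    (hpull : ∀ {A A' : (BiKummerSetting.mkOfConnectedTemperoid X tf hZ hP NH A₀ hA₀ hA₀').C} (φ : A ⟶ A') (u : (ofConnectedTemperoidData h (RD.levelStub ιX) odd_l R ιX K' constEmb constEmb_injective hinvc hinvp).muTorsion A' (ofConnectedTemperoidData h (RD.levelStub ιX) odd_l R ιX K' constEmb constEmb_injective hinvc hinvp).N)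
      (hu : Ψ.functor.mapAut A' (u : Aut A') ∈ (ofConnectedTemperoidData h (RD.levelStub ιX) odd_l R ιX K' constEmb constEmb_injective hinvc hinvp).muTorsion (Ψ.functor.obj A') (ofConnectedTemperoidData h (RD.levelStub ιX) odd_l R ιX K' constEmb constEmb_injective hinvc hinvp).N),
      Ψ.functor.mapAut A ((ofConnectedTemperoidData h (RD.levelStub ιX) odd_l R ιX K' constEmb constEmb_injective hinvc hinvp).muTorsionPull φ (ofConnectedTemperoidData h (RD.levelStub ιX) odd_l R ιX K' constEmb constEmb_injective hinvc hinvp).N u : Aut A) = ((ofConnectedTemperoidData h (RD.levelStub ιX) odd_l R ιX K' constEmb constEmb_injective hinvc hinvp).muTorsionPull (Ψ.functor.map φ) (ofConnectedTemperoidData h (RD.levelStub ιX) odd_l R ιX K' constEmb constEmb_injective hinvc hinvp).N ⟨_, hu⟩ : Aut (Ψ.functor.obj A)))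
    -- the NORMALISED Thm 5.7 transport (D_c = 1, e = 1: abc-iut-L2-d4 T1 + abc-iut-w5-d245 `capCupTransport_normalise`)
    (α : Ψ.functor.obj (ofConnectedTemperoidData h (RD.levelStub ιX) odd_l R ιX K' constEmb constEmb_injective hinvc hinvp).AN ≅ (ofConnectedTemperoidData h (RD.levelStub ιX) odd_l R ιX K' constEmb constEmb_injective hinvc hinvp).AN) (β : Ψ.functor.obj (ofConnectedTemperoidData h (RD.levelStub ιX) odd_l R ιX K' constEmb constEmb_injective hinvc hinvp).BN ≅ (ofConnectedTemperoidData h (RD.levelStub ιX) odd_l R ιX K' constEmb constEmb_injective hinvc hinvp).BN) {Dp₀ : Aut (ofConnectedTemperoidData h (RD.levelStub ιX) odd_l R ιX K' constEmb constEmb_injective hinvc hinvp).BN}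
    (hc₁ : α.inv ≫ Ψ.functor.map (ofConnectedTemperoidData h (RD.levelStub ιX) odd_l R ιX K' constEmb constEmb_injective hinvc hinvp).sCap ≫ β.hom = (ofConnectedTemperoidData h (RD.levelStub ιX) odd_l R ιX K' constEmb constEmb_injective hinvc hinvp).sCap)
    (hp₁ : α.inv ≫ Ψ.functor.map (ofConnectedTemperoidData h (RD.levelStub ιX) odd_l R ιX K' constEmb constEmb_injective hinvc hinvp).sCup ≫ β.hom = (ofConnectedTemperoidData h (RD.levelStub ιX) odd_l R ιX K' constEmb constEmb_injective hinvc hinvp).sCup ≫ Dp₀.hom) (hDp₀ : Dp₀ ∈ (ofConnectedTemperoidData h (RD.levelStub ιX) odd_l R ιX K' constEmb constEmb_injective hinvc hinvp).units (ofConnectedTemperoidData h (RD.levelStub ιX) odd_l R ιX K' constEmb constEmb_injective hinvc hinvp).BN)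
    -- of the four MODEL HYPOTHESES of [FrdI] Thm 3.4 (iii)/(v) only `Φ` non-dilating remains ([EtTh] Thm 3.7 (ii)); `D` of FSM-type, `D` slim, `∃` non-group-like are THEOREMS
    (hnd : IsNonDilatingOn tf.divisorMonoid)
    -- [EtTh] Cor 2.18 (i): the theta-related subquotients Π^tp_Ÿ, (l·Δ_Θ), … of Π^tp_X are CHARACTERISTIC (abc-iut-L2-t2's
    -- `RigidData.Cor218_i`, F-0620; discharged at the model data by abc-iut-L2-t8/L6) — supplies hP24/hγL for EVERY γ
    (h218i : RD.Cor218_i)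
    -- Lemma 5.9 (iv) BY NAME (node EtTh:Lem5.9(iv)) at an honest `DK`, sections supplied by `H : Facts`
    (DK : Set (TopOut (ofConnectedTemperoidData h (RD.levelStub ιX) odd_l R ιX K' constEmb constEmb_injective hinvc hinvp).EPiN))
    (h59iv : (ofConnectedTemperoidData h (RD.levelStub ιX) odd_l R ιX K' constEmb constEmb_injective hinvc hinvp).EnvIsoBiTheta H.sectionsFactor (ofConnectedTemperoidData h (RD.levelStub ιX) odd_l R ιX K' constEmb constEmb_injective hinvc hinvp).outerActionLZ_of H.sgpCapSection H.sgpCupSection H.constantsEqNormalizer DK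
      RD.toThetaEnvData (ContinuousMulEquiv.refl _)) :
    ∃ ρ : RigidityFamily (ofConnectedTemperoidData h (RD.levelStub ιX) odd_l R ιX K' constEmb constEmb_injective hinvc hinvp), ThetaSubquotientProjGalois.IsKummerDetermined (𝔉 := ofConnectedTemperoidData h (RD.levelStub ιX) odd_l R ιX K' constEmb constEmb_injective hinvc hinvp) P ρ hB ∧ IsFunctorialLinear (ofConnectedTemperoidData h (RD.levelStub ιX) odd_l R ιX K' constEmb constEmb_injective hinvc hinvp) ρ ∧
      (∀ ρ' : RigidityFamily (ofConnectedTemperoidData h (RD.levelStub ιX) odd_l R ιX K' constEmb constEmb_injective hinvc hinvp), ThetaSubquotientProjGalois.IsKummerDetermined (𝔉 := ofConnectedTemperoidData h (RD.levelStub ιX) odd_l R ιX K' constEmb constEmb_injective hinvc hinvp) P ρ' hB → IsFunctorialLinear (ofConnectedTemperoidData h (RD.levelStub ιX) odd_l R ιX K' constEmb constEmb_injective hinvc hinvp) ρ' → ρ' = ρ) ∧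
      CyclotomicRigidityPreserved (ofConnectedTemperoidData h (RD.levelStub ιX) odd_l R ιX K' constEmb constEmb_injective hinvc hinvp) Ψ ρ
        (deltaTransport.{u₀, v₀, w'} ιX h odd_l R K' constEmb constEmb_injective hinvc hinvp Ψ Ψbs eΨ φ η φQ φΛ hq hι) ∧
      (ofConnectedTemperoidData h (RD.levelStub ιX) odd_l R ιX K' constEmb constEmb_injective hinvc hinvp).CycRigidityCoincide
        ((ofConnectedTemperoidData h (RD.levelStub ιX) odd_l R ιX K' constEmb constEmb_injective hinvc hinvp).rho219OfBiTheta H.sectionsFactor (ofConnectedTemperoidData h (RD.levelStub ιX) odd_l R ιX K' constEmb constEmb_injective hinvc hinvp).outerActionLZ_of H.sgpCapSection H.sgpCupSection H.constantsEqNormalizer DK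
          RD.toThetaEnvData (ContinuousMulEquiv.refl _) h59iv.2.2.choose_spec.choose h59iv.2.2.choose_spec.choose_spec.choose
          h59iv.2.2.choose_spec.choose_spec.choose_spec.1 (ν.trans m)) ρ hB := by
  -- the knit, elaborated AGAINST ITS STATED TYPE (as in `Sec5Thm56EndKnitLevelNPsiModelHyps`; without the expected type the 46-argument
  -- application's implicit structure arguments are inferred by postponed higher-order unification, which is prohibitively slow here)
  have hK4 :
      ∃ ρ : RigidityFamily (ofConnectedTemperoidData h (RD.levelStub ιX) odd_l R ιX K' constEmb constEmb_injective hinvc hinvp), ThetaSubquotientProjGalois.IsKummerDetermined (𝔉 := ofConnectedTemperoidData h (RD.levelStub ιX) odd_l R ιX K' constEmb constEmb_injective hinvc hinvp) P ρ hB ∧ IsFunctorialLinear (ofConnectedTemperoidData h (RD.levelStub ιX) odd_l R ιX K' constEmb constEmb_injective hinvc hinvp) ρ ∧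
        (∀ ρ' : RigidityFamily (ofConnectedTemperoidData h (RD.levelStub ιX) odd_l R ιX K' constEmb constEmb_injective hinvc hinvp), ThetaSubquotientProjGalois.IsKummerDetermined (𝔉 := ofConnectedTemperoidData h (RD.levelStub ιX) odd_l R ιX K' constEmb constEmb_injective hinvc hinvp) P ρ' hB → IsFunctorialLinear (ofConnectedTemperoidData h (RD.levelStub ιX) odd_l R ιX K' constEmb constEmb_injective hinvc hinvp) ρ' → ρ' = ρ) ∧
        CyclotomicRigidityPreserved (ofConnectedTemperoidData h (RD.levelStub ιX) odd_l R ιX K' constEmb constEmb_injective hinvc hinvp) Ψ ρ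
          (deltaTransport.{u₀, v₀, w'} ιX h odd_l R K' constEmb constEmb_injective hinvc hinvp Ψ Ψbs eΨ φ η φQ φΛ hq hι) :=
    exists_rigidityFamily_unique_preserved_ofConnectedTemperoidData_levelN_projPin_modelHyps_psi_galois.{u₀, v₀, w', v₁, u₁} h odd_l R ιX K'
      constEmb constEmb_injective hinvc hinvp hB P hPpre hPproj_pin hη₀ hdies ν hKν hP34 hΔcnst hreach H m hme hχX hH Ψ Ψbs eΨ φ η φQ φΛ hq hι
      hlin hpull α β hc₁ hp₁ hDp₀ hnd h218i
  obtain ⟨ρ, hK, hL, hU, hΨ⟩ := hK4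
  exact ⟨ρ, hK, hL, hU, hΨ,
    cycRigidityCoincide_ofConnectedTemperoidData_levelN_of_hme_galois.{u₀, v₀, w'} h odd_l R ιX K' constEmb constEmb_injective hinvc hinvp
      H.sectionsFactor (ofConnectedTemperoidData h (RD.levelStub ιX) odd_l R ιX K' constEmb constEmb_injective hinvc hinvp).outerActionLZ_of H.sgpCapSection H.sgpCupSection H.constantsEqNormalizer DK h59iv hB P hPpre ν m hme ρ hK⟩

end Connected

end ThetaFrobenioid

end Literature.AnabelianGeometry.EtaleTheta

end
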